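import Summits.ValiantsHypothesis.ValiantsHypothesis.Theorems.LacunarySymmetroidMatrixDescartesCensusInteriorDefiniteK4False
import Summits.ValiantsHypothesis.ValiantsHypothesis.Theorems.LacunarySymmetroidMatrixDescartesStubDescartesCeiling
import Summits.ValiantsHypothesis.ValiantsHypothesis.Theorems.KPlusLogSqLawWeakLiftingTowerGraftTowerRowTwoSym
import Summits.ValiantsHypothesis.ValiantsHypothesis.Theorems.KPlusLogSqLawWeakLiftingTowerGraftSizeSuperadditive
import Summits.ValiantsHypothesis.ValiantsHypothesis.Theorems.LacunarySymmetroidMatrixDescartesDescartesSharpOnSupport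

/-!
# Tower graft line, `m = 2` rung — THE `K = 4` TOWER ROW IS DESCARTES-SHARP: `ζ₊(2; (0,1,3,20)) = 9`;
# the symmetric patchwork count `3K − 4` is NOT the truth on towers, and a linear tower cap needs slope `≥ 3`

LINE (B) `tower_graft` of crux `WeakLifting` (stmt-ValiantsHypothesis-19561).  Its first open fixed-size rung (hands g2/g3 of this
unit) is the `m = 2` graft rung «∃ C ∀ K B D (2-tower d), PosRootLawOn 2 K B d → PosRootLawOn 2 (K+1) (2^C B + 2^C) (Fin.snoc d D)»,
whose fate as `K → ∞` is decided by the growth of `ζ₊(2; d)` on 2-towers between the tree's floor `3K − 4`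
(`TowerRowTwoSym.not_posRootLawOn_two_tower`, the symmetric tropical optimum `T_sym(2,K)` realised on every 2-tower) and Descartes
`C(K+1,2) − 1`.  Hand g3 recorded «heuristic evidence that the truth on towers is `3K − 4`» and asked for a census of `K = 4..7`
(«one tower pencil with 9 at `K = 4` kills TowerRowTwoLinearCap-with-`c < 9/4` and the generic-model conjecture»).  That pencil is
ALREADY IN THE TREE: the object-search cell's `Census.not_posRootLawOn_two_four_eight_tower` (`…CensusInteriorDefiniteK4False`,
engine-1 g7's TOWER nine `E1G7-TOWER9-m2K4-d0-1-3-20`, 2026-08-23).  This short corollary file reads it in the line's currency: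

* `tower_0_1_3_20` — `(0,1,3,20)` is a 2-tower (`2·d l < d l'`, the line's `IsTower 2` inlined);
* `nine_le_of_posRootLawOn_tower_0_1_3_20` + `posRootLawOn_two_four_nine` — **`ζ₊(2; (0,1,3,20)) = 9 = D(2,4)` exactly**: the
  `K = 4` tower row is DESCARTES-SHARP (one above `3K − 4 = 8`; the symmetric tropical ceiling `T_sym(2,4) = 8` of
  `tropRow_two_symm_le` is therefore NOT a ceiling for real symmetric pencils on towers — the real count matches the GENERAL tropical row
  `T(2,4) = 4K − 7 = 9` instead);
* ★ `not_towerRowTwo_eq_patchworkFloor` — the conjecture «`PosRootLawOn 2 K (3K − 4) d` on every 2-tower, `K ≥ 3`» is FALSE;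
* ★ `nine_le_of_towerRowTwoCap` / `nine_le_four_mul_of_towerRowTwoLinearCap` — any tower cap `f` (`PosRootLawOn 2 K (f K) d` on all
  2-towers) has `f 4 ≥ 9`; a LINEAR cap `c·K` needs `4c ≥ 9`, i.e. `c ≥ 3`, at least the slope of the floor `3K − 4` itself;
* `not_posRootLawOn_even_tower_K4` / `not_posRootLawOn_odd_tower_K4` (+ instances `(3,4) ≥ 12`, `(4,4) ≥ 18` on `(0,1,3,20)`) — the nine
  propagated to all sizes by the tree's direct sums (`not_posRootLawOn_mul` / `not_posRootLawOn_add`), one per block above hand g3's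
  all-tower floors `floor_tower_sizes` (`8n`, `8n + 3`).

LOCATED, NOT KERNEL (pub-symmetroid CENSUS.md ADDENDA 3–6b + «THEOREMS OF RECORD», for the next hand — do not re-derive): tower nines
exist on `(0,1,3,N)` for `N ∈ {15,16,18,20,21,24,…}`, on `(0,1,4,39)`, `(0,2,5,32)`; `ζ(2,4; (0,1,3,7)) = 8` is a theorem of record of
the cell (Schur-positivity certificate with 51 092 Littlewood–Richardson coefficients, outside the kernel) — so the `K = 4` tower value is
NOT an invariant of the pair-sum order type (`(0,1,3,7)` and `(0,1,3,20)` share it); `K = 5`: tower thirteens `= D − 1` (companion kernel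
file `…TowerRowTwoK5Tower`, this seat); `K = 6`: a tower sixteen `= D − 4` on `(0,1,3,15,135,1000)` (3641-digit witness, not typed).
So the located tower records read `9 / 13 / 16` against `3K − 4 = 8 / 11 / 14`: increments `+4, +3` — consistent with LINEAR growth of
slope `3–4`, NOT evidence for a quadratic floor; the rung's cap side (`TowerRowTwoLinearCap` with some `c ≥ 3`, a Descartes-beating
fewnomial bound) remains the live research statement, exactly as hand g3 left it, with the constant now bounded below.

HONEST FRAMING: corollaries of kernel theorems of the tree (zero slack) + bookkeeping; NO stub of the line is claimed; nothing on
S4/S4b/S5, `WeakLifting`, `TropicalB`, Conjecture B, `MatrixDescartes` (18050), `DoorA26` or `VP ≠ VNP`.  Def-free.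
Seat: prover leafhand-val-kpluslogsqlaw-1 g4, `--supports stmt-ValiantsHypothesis-19561`.  [folklore] elementary.
-/

-- `Summit.ValiantsHypothesis.ValiantsHypothesis.…` repeats a component by the D-0017 layout
-- (single-conjunct summit), which the `dupNamespace` linter flags; the name is mandated.
set_option linter.dupNamespace false
set_option autoImplicit false

namespace Summit.ValiantsHypothesis.ValiantsHypothesis.Theorems.KPlusLogSqLaw.TowerGraft

open Summit.ValiantsHypothesis.ValiantsHypothesis.Theorems.LacunarySymmetroidMatrixDescartes (PosRootLawOn)
open Summit.ValiantsHypothesis.ValiantsHypothesis.Theorems.LacunarySymmetroidMatrixDescartes.Census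
  (not_posRootLawOn_two_four_eight_tower)

namespace TowerRowTwoSharp

/-- `(0, 1, 3, 20)` is a 2-TOWER (`2·d l < d l'` for `l < l'`; the line's `IsTower 2`, inlined). [folklore] -/
theorem tower_0_1_3_20 :
    ∀ l l' : Fin 4, l < l' → 2 * (![0, 1, 3, 20] : Fin 4 → ℕ) l < (![0, 1, 3, 20] : Fin 4 → ℕ) l' := by
  decide

/-- **`9 ≤ B`** for every valid class budget `PosRootLawOn 2 4 B` on the 2-tower `(0,1,3,20)` (the cell's TOWER nine). [folklore] -/
theorem nine_le_of_posRootLawOn_tower_0_1_3_20 {B : ℕ} (h : PosRootLawOn 2 4 B (![0, 1, 3, 20] : Fin 4 → ℕ)) : 9 ≤ B := by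
  by_contra hB
  exact not_posRootLawOn_two_four_eight_tower (fun S hS => (h S hS).trans (by omega))

/-- Descartes from above: `PosRootLawOn 2 4 9 d` on EVERY support (`C(5,2) − 1 = 9`, tree `stub_descartesCeiling`); with the nine,
**`ζ₊(2; (0,1,3,20)) = 9` exactly — the `K = 4` tower row is Descartes-sharp.** [folklore] -/
theorem posRootLawOn_two_four_nine (d : Fin 4 → ℕ) : PosRootLawOn 2 4 9 d := by
  intro S _
  have h := LacunarySymmetroidMatrixDescartes.stub_descartesCeiling 4 2 (by norm_num) d S
  have h10 : Nat.choose (2 + 4 - 1) 2 = 10 := by decide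
  omega

/-- the least valid budget on `(0,1,3,20)` is `9`: `PosRootLawOn 2 4 B (0,1,3,20) ↔ 9 ≤ B`. [this work] -/
theorem posRootLawOn_tower_0_1_3_20_iff (B : ℕ) : PosRootLawOn 2 4 B (![0, 1, 3, 20] : Fin 4 → ℕ) ↔ 9 ≤ B :=
  ⟨nine_le_of_posRootLawOn_tower_0_1_3_20, fun hB S hS => (posRootLawOn_two_four_nine _ S hS).trans hB⟩

/-- ★ **The symmetric patchwork count is NOT the truth on towers**: the conjecture «`ζ₊(2; d) = 3K − 4` on every 2-tower with
`K ≥ 3` letters», i.e. `PosRootLawOn 2 K (3K − 4) d` for all such `d` (the floor `TowerRowTwoSym.not_posRootLawOn_two_tower` being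
`3K − 4 ≤ ζ₊`), FAILS at `K = 4` on `(0,1,3,20)` (`8 < 9`). [this work] -/
theorem not_towerRowTwo_eq_patchworkFloor :
    ¬ ∀ (K : ℕ) (d : Fin K → ℕ), 3 ≤ K → (∀ l l' : Fin K, l < l' → 2 * d l < d l') → PosRootLawOn 2 K (3 * K - 4) d := by
  intro h
  have h9 := nine_le_of_posRootLawOn_tower_0_1_3_20 (h 4 _ (by norm_num) tower_0_1_3_20)
  omega

/-- **Any tower cap is at least Descartes at `K = 4`**: if `f` bounds `ζ₊(2; d)` on every 2-tower with `K` letters, then `9 ≤ f 4`.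
[this work] -/
theorem nine_le_of_towerRowTwoCap {f : ℕ → ℕ}
    (h : ∀ (K : ℕ) (d : Fin K → ℕ), (∀ l l' : Fin K, l < l' → 2 * d l < d l') → PosRootLawOn 2 K (f K) d) : 9 ≤ f 4 :=
  nine_le_of_posRootLawOn_tower_0_1_3_20 (h 4 _ tower_0_1_3_20)

/-- ★ **A LINEAR tower cap needs slope `≥ 3` already from `K = 4`**: if «`PosRootLawOn 2 K (c·K) d` on every 2-tower» (hand g3's
`TowerRowTwoLinearCap` with constant `c`), then `9 ≤ 4c` — so `3 ≤ c`, no linear cap below the slope of the floor `3K − 4` is possible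
(the conclusion `3 ≤ c` itself is `TowerRowTwoK5.three_le_of_towerRowTwoLinearCap` of the companion file, from the `K = 5` thirteen;
here the sharper `K = 4` inequality). [this work] -/
theorem nine_le_four_mul_of_towerRowTwoLinearCap {c : ℕ}
    (h : ∀ (K : ℕ) (d : Fin K → ℕ), (∀ l l' : Fin K, l < l' → 2 * d l < d l') → PosRootLawOn 2 K (c * K) d) : 9 ≤ 4 * c := by
  have h9 : 9 ≤ c * 4 := nine_le_of_towerRowTwoCap (f := fun K => c * K) h
  omega

/-- the floor and the nine together: on 2-towers with `4` letters the least budgets range over `{8, 9}` ∋ `9`, i.e. the all-tower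
statement `PosRootLawOn 2 4 B d` for every 2-tower `d : Fin 4 → ℕ` holds iff `9 ≤ B`. [this work] -/
theorem forall_tower_four_posRootLawOn_iff (B : ℕ) :
    (∀ d : Fin 4 → ℕ, (∀ l l' : Fin 4, l < l' → 2 * d l < d l') → PosRootLawOn 2 4 B d) ↔ 9 ≤ B :=
  ⟨fun h => nine_le_of_posRootLawOn_tower_0_1_3_20 (h _ tower_0_1_3_20),
    fun hB d _ S hS => (posRootLawOn_two_four_nine d S hS).trans hB⟩

/-! ### The nine at every size on `(0,1,3,20)` (direct sums) -/

/-- **even sizes**: `ζ₊(2(n+1); (0,1,3,20)) ≥ 9(n+1)` (`n + 1` rescaled diagonal copies of the nine, `not_posRootLawOn_mul`); the all-tower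
floor of hand g3 gives `8(n+1)`. [this work] -/
theorem not_posRootLawOn_even_tower_K4 (n : ℕ) :
    ¬ PosRootLawOn ((n + 1) * 2) 4 ((n + 1) * 9 - 1) (![0, 1, 3, 20] : Fin 4 → ℕ) :=
  not_posRootLawOn_mul not_posRootLawOn_two_four_eight_tower n

/-- **odd sizes**: `ζ₊(2(n+1) + 1; (0,1,3,20)) ≥ 9(n+1) + 3` (plus one Descartes-sharp `1 × 1` block, `DescartesSharp.not_posRootLawOn_one`);
the all-tower floor gives `8(n+1) + 3`. [this work] -/
theorem not_posRootLawOn_odd_tower_K4 (n : ℕ) :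
    ¬ PosRootLawOn ((n + 1) * 2 + 1) 4 ((n + 1) * 9 + 2) (![0, 1, 3, 20] : Fin 4 → ℕ) := by
  have hinj : Function.Injective (![0, 1, 3, 20] : Fin 4 → ℕ) := by decide
  have h1 := LacunarySymmetroidMatrixDescartes.DescartesSharp.not_posRootLawOn_one (K := 4) (by norm_num) hinj
  have h := not_posRootLawOn_add (not_posRootLawOn_even_tower_K4 n) h1
  rwa [show (n + 1) * 9 - 1 + (4 - 2) + 1 = (n + 1) * 9 + 2 by omega] at h

/-- instance `(3, 4)` on `(0,1,3,20)`: `ζ₊(3; (0,1,3,20)) ≥ 12` (`¬ PosRootLawOn 3 4 11`; all-tower floor `11`). [this work] -/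
theorem not_posRootLawOn_three_four_tower_11 : ¬ PosRootLawOn 3 4 11 (![0, 1, 3, 20] : Fin 4 → ℕ) := by
  have h := not_posRootLawOn_odd_tower_K4 0
  norm_num at h
  exact h

/-- instance `(4, 4)` on `(0,1,3,20)`: `ζ₊(4; (0,1,3,20)) ≥ 18` (`¬ PosRootLawOn 4 4 17`; all-tower floor `16`,
`TowerRowTwoSym.not_posRootLawOn_four_four_tower`). [this work] -/
theorem not_posRootLawOn_four_four_tower_17 : ¬ PosRootLawOn 4 4 17 (![0, 1, 3, 20] : Fin 4 → ℕ) := by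
  have h := not_posRootLawOn_even_tower_K4 1
  norm_num at h
  exact h

end TowerRowTwoSharp

end Summit.ValiantsHypothesis.ValiantsHypothesis.Theorems.KPlusLogSqLaw.TowerGraft
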